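import Literature.NumberTheory.LFunctions.MontgomerySmallGapsTriangleKernel
import Summits.Ventures.PQCStructure.Ladder.SlotBiasMLKEMExactCert
import Summits.RiemannHypothesis.RiemannHypothesis.Theses.GapsEvoDoors

/-!
# GapsEvoDoors — the FLOOR-FRAGMENT search object `DeltaCIFloorNineTenths` has an elementary witness

Item stmt-RiemannHypothesis-23031 of route GapsEvoDoors (cell rh-gaps, D-0143/D-0145; LINE L11-a3
«floor fragment»): for some window `Δ ≥ 1`, some `0 < λ < 1/2`, some `0 ≤ f < 9/10` and some
`r ∈ 𝒜_Δ(λ)` (even, continuous, `L¹`, `r̂ ∈ L¹`, `r ≤ 1`, `r ≤ 0` off `[−λ, λ]`, `r̂ ≥ 0` for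
`|α| ≥ Δ`) with `r̂ ≥ 0` on `1 ≤ |α| ≤ Δ`, the floor certificate
`c_fl(r; Δ, f) = r̂(0) − 1 + 2∫₀¹ α r̂(α) dα + 2f ∫₁^Δ r̂(α) dα` is positive.

WITNESS (elementary; no engine object, no interval arithmetic): Montgomery's triangle
`r(u) = max(1 − |u|/λ, 0)` at `(Δ, λ, f) = (100, 0.499, 0.89)`. Its cosine transform is the Fejér
kernel `r̂(α) = λ·sinc(πλα)²` (tree: `Montgomery1973.cosTransform_triangle`), non-negative
EVERYWHERE, so every sign clause is free and the window `Δ` only enters through the tail. The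
certificate is bounded below in closed form:

* `r̂(0) = λ`, and `∫₀¹ α r̂ ≥ λ(1/2 − c²/12 + c⁴/135 − c⁶/2520)`, `c = πλ`
  (from `cos y ≤ 1 − y²/2 + y⁴/4! − y⁶/6! + y⁸/8!`, exactly as the tree's certified
  `MontgomerySmallGaps.criterion_068`);
* `∫₁^Δ r̂ = 1/2 − ∫₀¹ r̂ − ∫_Δ^∞ r̂` from FOURIER INVERSION AT `0` (`∫_ℝ r̂ = r(0) = 1`, tree
  `BGMM2023.fourier_cosTransform_eq`) and evenness; `∫₀¹ r̂ ≤ λ(1 − c²/9 + 2c⁴/225)`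
  (from `cos y ≥ 1 − y²/2 + y⁴/4! − y⁶/6!`) and `∫_Δ^∞ r̂ ≤ ∫_Δ^∞ dα/(π²λα²) = 1/(π²λΔ)`;
* with `3.141592 < π < 3.141593` (Mathlib) the resulting rational-in-`π` lower bound is
  `c_fl ≥ 0.0254…` (float value of `c_fl` itself: `0.0332`; true `∫₁^{100} r̂ = 0.1125`).

So `c_fl(r; 100, 0.89) > 0` with `f = 0.89 < 9/10` and `λ = 0.499 < 1/2`, which is the item.
(The two-sided certificate of the same object is `c(r; 100, ε) = c_fl(r; 100, 1 − ε)`, positive for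
`ε ≤ 0.11`; the cell's CERTIFIED engine witnesses of record for this item — eng-2 PW-SOS `n = 6`
at `(2, 17/20, 12/25)`, `c_fl ≥ 0.0056819`, and eng-1 HG at the same cell, `0.0050283`, referee
V-17/V-20 — are sharper in `Δ` but need polynomial sign certificates; the triangle needs none.)

What this is NOT: a statement about zeta zeros. `DeltaCIFloorNineTenths` is a pure real-analysis
`∃`; it feeds the crux `FragmentToCI` only through the analytic port `FloorSpacingCriterionAll`
(item 23032, open) and the bridge `SpacingToCI` (item 22423, open), both RH-conditional. computed ≠
proved applies to every cell number quoted above except the inequality proved here; nothing here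
bears on the truth of RH.

References: H. L. Montgomery, Proc. Sympos. Pure Math. 24 (1973) 181–193, §4 (the triangle kernel);
Bui–Goldston–Milinovich–Montgomery, Acta Arith. 210 (2023), arXiv:2208.02359, §2 (class `𝒜(λ)`,
`r̂`); cell rh-gaps PREREG-GAPS-9 (floor axis A3), route GapsEvoDoors rev 14 docstring of 23031.
-/

noncomputable section

open Filter Set MeasureTheory Real
open scoped Topology FourierTransform

set_option linter.dupNamespace false  -- the mandated namespace repeats `RiemannHypothesis`

namespace Summit.RiemannHypothesis.RiemannHypothesis.Theorems.GapsEvoDoorsFloor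

open Literature.NumberTheory.LFunctions

/-! ## §1. Pointwise bounds for `sin²` and `sinc²` from the global Taylor inequalities
`T₆ ≤ cos ≤ T₈` (tree: `Summit.Ventures.PQCStructure.Ladder.SlotBiasMLKEM{Lower,Exact}Cert`), and two
exact polynomial integrals (the `sinc²` lower bound and `∫ poly` are adapted from the private lemmas of
`Literature/NumberTheory/LFunctions/MontgomerySmallGapsProofs.lean` §N, not importable) -/

/-- `sin² x ≥ x² − x⁴/3 + 2x⁶/45 − x⁸/315` for all real `x`. -/
theorem sin_sq_ge (x : ℝ) :
    x ^ 2 - x ^ 4 / 3 + 2 * x ^ 6 / 45 - x ^ 8 / 315 ≤ sin x ^ 2 := by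
  wlog hx : 0 ≤ x generalizing x
  · have h := this (-x) (by linarith)
    rw [sin_neg, neg_sq] at h
    have e : (-x) ^ 2 - (-x) ^ 4 / 3 + 2 * (-x) ^ 6 / 45 - (-x) ^ 8 / 315 =
        x ^ 2 - x ^ 4 / 3 + 2 * x ^ 6 / 45 - x ^ 8 / 315 := by ring
    linarith
  rw [sin_sq_eq_half_sub]
  have h := Summit.Ventures.PQCStructure.Ladder.SlotBiasMLKEMExactCert.cos_le_taylor8
    (x := 2 * x) (by linarith)
  have e1 : (2 * x) ^ 2 = 4 * x ^ 2 := by ring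
  have e2 : (2 * x) ^ 4 = 16 * x ^ 4 := by ring
  have e3 : (2 * x) ^ 6 = 64 * x ^ 6 := by ring
  have e4 : (2 * x) ^ 8 = 256 * x ^ 8 := by ring
  rw [e1, e2, e3, e4] at h
  linarith

/-- `sin² x ≤ x² − x⁴/3 + 2x⁶/45` for all real `x`. -/
theorem sin_sq_le (x : ℝ) :
    sin x ^ 2 ≤ x ^ 2 - x ^ 4 / 3 + 2 * x ^ 6 / 45 := by
  wlog hx : 0 ≤ x generalizing x
  · have h := this (-x) (by linarith)
    rw [sin_neg, neg_sq] at h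
    have e : (-x) ^ 2 - (-x) ^ 4 / 3 + 2 * (-x) ^ 6 / 45 =
        x ^ 2 - x ^ 4 / 3 + 2 * x ^ 6 / 45 := by ring
    linarith
  rw [sin_sq_eq_half_sub]
  have h := Summit.Ventures.PQCStructure.Ladder.SlotBiasMLKEMLowerCert.taylor_le_cos
    (x := 2 * x) (by linarith)
  have e1 : (2 * x) ^ 2 = 4 * x ^ 2 := by ring
  have e2 : (2 * x) ^ 4 = 16 * x ^ 4 := by ring
  have e3 : (2 * x) ^ 6 = 64 * x ^ 6 := by ring
  rw [e1, e2, e3] at h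
  linarith

/-- `a sinc²(c a) ≥ a − c²a³/3 + 2c⁴a⁵/45 − c⁶a⁷/315` for `a ≥ 0`. -/
theorem mul_sinc_sq_ge {a : ℝ} (ha : 0 ≤ a) (c : ℝ) :
    a - c ^ 2 * a ^ 3 / 3 + 2 * c ^ 4 * a ^ 5 / 45 - c ^ 6 * a ^ 7 / 315 ≤
      a * sinc (c * a) ^ 2 := by
  rcases eq_or_ne c 0 with hc | hc
  · subst hc; simp
  rcases ha.eq_or_lt with ha0 | ha0
  · subst ha0; simp
  have h0 : c * a ≠ 0 := mul_ne_zero hc ha0.ne'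
  rw [sinc_of_ne_zero h0, div_pow]
  have key := sin_sq_ge (c * a)
  rw [show a * (sin (c * a) ^ 2 / (c * a) ^ 2) = sin (c * a) ^ 2 * (a / (c * a) ^ 2) by ring]
  have h2 : a - c ^ 2 * a ^ 3 / 3 + 2 * c ^ 4 * a ^ 5 / 45 - c ^ 6 * a ^ 7 / 315 =
      ((c * a) ^ 2 - (c * a) ^ 4 / 3 + 2 * (c * a) ^ 6 / 45 - (c * a) ^ 8 / 315) *
        (a / (c * a) ^ 2) := by
    field_simp
  rw [h2]
  exact mul_le_mul_of_nonneg_right key (by positivity)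

/-- `sinc²(c a) ≤ 1 − c²a²/3 + 2c⁴a⁴/45`. -/
theorem sinc_sq_le (a c : ℝ) :
    sinc (c * a) ^ 2 ≤ 1 - c ^ 2 * a ^ 2 / 3 + 2 * c ^ 4 * a ^ 4 / 45 := by
  rcases eq_or_ne (c * a) 0 with h0 | h0
  · rw [h0, sinc_zero, one_pow]
    rcases mul_eq_zero.mp h0 with hc | ha
    · subst hc; simp
    · subst ha; simp
  rw [sinc_of_ne_zero h0, div_pow]
  have key := sin_sq_le (c * a)
  have hpos : 0 < (c * a) ^ 2 := by positivity
  rw [div_le_iff₀ hpos]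
  have e : (1 - c ^ 2 * a ^ 2 / 3 + 2 * c ^ 4 * a ^ 4 / 45) * (c * a) ^ 2 =
      (c * a) ^ 2 - (c * a) ^ 4 / 3 + 2 * (c * a) ^ 6 / 45 := by ring
  rw [e]
  exact key

/-- `λ sinc²(πλa) ≤ 1/(π²λ a²)` for `a ≠ 0`, `λ > 0`. -/
theorem mul_sinc_sq_le_inv {lam a : ℝ} (hlam : 0 < lam) (ha : a ≠ 0) :
    lam * sinc (π * lam * a) ^ 2 ≤ 1 / (π ^ 2 * lam * a ^ 2) := by
  have h0 : π * lam * a ≠ 0 := by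
    have : π * lam ≠ 0 := by positivity
    exact mul_ne_zero this ha
  rw [sinc_of_ne_zero h0, div_pow]
  have hs : sin (π * lam * a) ^ 2 ≤ 1 := by
    rw [sq_le_one_iff_abs_le_one]; exact abs_sin_le_one _
  have hpos : 0 < (π * lam * a) ^ 2 := by positivity
  calc lam * (sin (π * lam * a) ^ 2 / (π * lam * a) ^ 2)
      ≤ lam * (1 / (π * lam * a) ^ 2) := by gcongr
    _ = 1 / (π ^ 2 * lam * a ^ 2) := by field_simp

/-- `∫₀¹ (a − c²a³/3 + 2c⁴a⁵/45 − c⁶a⁷/315) da = 1/2 − c²/12 + c⁴/135 − c⁶/2520`. -/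
theorem integral_poly (c : ℝ) :
    ∫ a in (0:ℝ)..1, (a - c ^ 2 * a ^ 3 / 3 + 2 * c ^ 4 * a ^ 5 / 45 - c ^ 6 * a ^ 7 / 315) =
      1 / 2 - c ^ 2 / 12 + c ^ 4 / 135 - c ^ 6 / 2520 := by
  have hd : ∀ a : ℝ, HasDerivAt (fun a : ℝ ↦ a ^ 2 / 2 - c ^ 2 * a ^ 4 / 12
      + 2 * c ^ 4 * a ^ 6 / 270 - c ^ 6 * a ^ 8 / 2520)
      (a - c ^ 2 * a ^ 3 / 3 + 2 * c ^ 4 * a ^ 5 / 45 - c ^ 6 * a ^ 7 / 315) a := by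
    intro a
    have h := ((((hasDerivAt_pow 2 a).div_const 2).fun_sub
      (((hasDerivAt_pow 4 a).const_mul (c ^ 2)).div_const 12)).fun_add
      (((hasDerivAt_pow 6 a).const_mul (2 * c ^ 4)).div_const 270)).fun_sub
      (((hasDerivAt_pow 8 a).const_mul (c ^ 6)).div_const 2520)
    refine h.congr_deriv ?_
    norm_num; ring
  rw [intervalIntegral.integral_eq_sub_of_hasDerivAt (fun a _ ↦ hd a)
    ((by fun_prop : Continuous fun a : ℝ ↦ a - c ^ 2 * a ^ 3 / 3 + 2 * c ^ 4 * a ^ 5 / 45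
      - c ^ 6 * a ^ 7 / 315).intervalIntegrable _ _)]
  ring

/-- `∫₀¹ (1 − c²a²/3 + 2c⁴a⁴/45) da = 1 − c²/9 + 2c⁴/225`. -/
theorem integral_poly₀ (c : ℝ) :
    ∫ a in (0:ℝ)..1, (1 - c ^ 2 * a ^ 2 / 3 + 2 * c ^ 4 * a ^ 4 / 45) =
      1 - c ^ 2 / 9 + 2 * c ^ 4 / 225 := by
  have hd : ∀ a : ℝ, HasDerivAt (fun a : ℝ ↦ a - c ^ 2 * a ^ 3 / 9 + 2 * c ^ 4 * a ^ 5 / 225)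
      (1 - c ^ 2 * a ^ 2 / 3 + 2 * c ^ 4 * a ^ 4 / 45) a := by
    intro a
    have h := (((hasDerivAt_id' a).fun_sub
      (((hasDerivAt_pow 3 a).const_mul (c ^ 2)).div_const 9)).fun_add
      (((hasDerivAt_pow 5 a).const_mul (2 * c ^ 4)).div_const 225))
    refine h.congr_deriv ?_
    norm_num; ring
  rw [intervalIntegral.integral_eq_sub_of_hasDerivAt (fun a _ ↦ hd a)
    ((by fun_prop : Continuous fun a : ℝ ↦ 1 - c ^ 2 * a ^ 2 / 3
      + 2 * c ^ 4 * a ^ 4 / 45).intervalIntegrable _ _)]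
  ring

/-! ## §2. Montgomery's triangle `r_λ(u) = max(1 − |u|/λ, 0)`: the three integrals of its transform -/

/-- `r̂_λ(0) = λ`. -/
theorem cosTransform_triangle_zero {lam : ℝ} (hlam : 0 < lam) :
    BGMM2023.cosTransform (fun u : ℝ ↦ max (1 - |u| / lam) 0) 0 = lam := by
  rw [Montgomery1973.cosTransform_triangle hlam, mul_zero, sinc_zero, one_pow, mul_one]

/-- `r̂_λ ∈ L¹(ℝ)` (tree: a continuous integrable even `r` with `r̂ ≥ 0` has integrable `r̂`). -/
theorem integrable_cosTransform_triangle {lam : ℝ} (hlam : 0 < lam) :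
    Integrable (BGMM2023.cosTransform (fun u : ℝ ↦ max (1 - |u| / lam) 0)) :=
  BGMM2023.integrable_cosTransform (Montgomery1973.continuous_triangle hlam)
    (Montgomery1973.integrable_triangle hlam) (Montgomery1973.isAdmissible_triangle hlam).even
    (Montgomery1973.isAdmissible_triangle hlam).transform_nonneg

/-- **Fourier inversion at the origin**: `∫_ℝ r̂_λ = r_λ(0) = 1`. -/
theorem integral_cosTransform_triangle {lam : ℝ} (hlam : 0 < lam) :
    ∫ α, BGMM2023.cosTransform (fun u : ℝ ↦ max (1 - |u| / lam) 0) α = 1 := by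
  set r : ℝ → ℝ := fun u ↦ max (1 - |u| / lam) 0 with hrdef
  have hA := Montgomery1973.isAdmissible_triangle hlam
  have hc : Continuous r := Montgomery1973.continuous_triangle hlam
  have hi : Integrable r := Montgomery1973.integrable_triangle hlam
  have heven : ∀ u, r (-u) = r u := hA.even
  have hnn : ∀ α, 0 ≤ BGMM2023.cosTransform r α := hA.transform_nonneg
  have hgi : Integrable (BGMM2023.cosTransform r) := BGMM2023.integrable_cosTransform hc hi heven hnn
  have hge : ∀ ξ, BGMM2023.cosTransform r (-ξ) = BGMM2023.cosTransform r ξ :=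
    BGMM2023.cosTransform_neg r
  have h1 := BGMM2023.fourier_cosTransform_eq hc hi heven hnn 0
  rw [BGMM2023.fourier_ofReal_eq_cosTransform hge hgi] at h1
  have h2 : BGMM2023.cosTransform (BGMM2023.cosTransform r) 0 = r 0 := by exact_mod_cast h1
  have h3 : r 0 = 1 := by simp [hrdef]
  rw [h3] at h2
  rw [← h2]
  unfold BGMM2023.cosTransform
  simp only [mul_zero, zero_mul, Real.cos_zero, mul_one]

/-- `∫_{α > 0} r̂_λ = 1/2` (evenness). -/
theorem integral_Ioi_cosTransform_triangle {lam : ℝ} (hlam : 0 < lam) :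
    ∫ α in Ioi (0:ℝ), BGMM2023.cosTransform (fun u : ℝ ↦ max (1 - |u| / lam) 0) α = 1 / 2 := by
  set g := BGMM2023.cosTransform (fun u : ℝ ↦ max (1 - |u| / lam) 0) with hgdef
  have hge : ∀ ξ, g (-ξ) = g ξ := BGMM2023.cosTransform_neg _
  have habs : (fun x : ℝ ↦ g |x|) = g := by
    funext x
    rcases le_or_gt 0 x with h | h
    · rw [abs_of_nonneg h]
    · rw [abs_of_neg h, hge]
  have h := integral_comp_abs (f := g)
  rw [habs, integral_cosTransform_triangle hlam] at h
  linarith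

/-- **The window integral through inversion**: `∫₁^Δ r̂_λ = 1/2 − ∫₀¹ r̂_λ − ∫_{α > Δ} r̂_λ`
(`Δ ≥ 1`). -/
theorem integral_window_eq {lam Δ : ℝ} (hlam : 0 < lam) (hΔ : 1 ≤ Δ) :
    ∫ α in (1:ℝ)..Δ, BGMM2023.cosTransform (fun u : ℝ ↦ max (1 - |u| / lam) 0) α =
      1 / 2 - (∫ α in (0:ℝ)..1, BGMM2023.cosTransform (fun u : ℝ ↦ max (1 - |u| / lam) 0) α)
        - ∫ α in Ioi Δ, BGMM2023.cosTransform (fun u : ℝ ↦ max (1 - |u| / lam) 0) α := by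
  set g := BGMM2023.cosTransform (fun u : ℝ ↦ max (1 - |u| / lam) 0) with hgdef
  have hgi : Integrable g := integrable_cosTransform_triangle hlam
  have h01 : (∫ α in Ioi (0:ℝ), g α) - ∫ α in Ioi (1:ℝ), g α = ∫ α in (0:ℝ)..1, g α :=
    intervalIntegral.integral_Ioi_sub_Ioi hgi.integrableOn zero_le_one
  have h1Δ : (∫ α in Ioi (1:ℝ), g α) - ∫ α in Ioi Δ, g α = ∫ α in (1:ℝ)..Δ, g α :=
    intervalIntegral.integral_Ioi_sub_Ioi hgi.integrableOn hΔ
  rw [integral_Ioi_cosTransform_triangle hlam] at h01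
  linarith

/-- **Tail**: `∫_{α > Δ} r̂_λ ≤ 1/(π²λΔ)` (`Δ > 0`), since `r̂_λ(α) ≤ 1/(π²λα²)`. -/
theorem integral_tail_le {lam Δ : ℝ} (hlam : 0 < lam) (hΔ : 0 < Δ) :
    ∫ α in Ioi Δ, BGMM2023.cosTransform (fun u : ℝ ↦ max (1 - |u| / lam) 0) α ≤
      1 / (π ^ 2 * lam * Δ) := by
  set g := BGMM2023.cosTransform (fun u : ℝ ↦ max (1 - |u| / lam) 0) with hgdef
  have hgi : Integrable g := integrable_cosTransform_triangle hlam
  have hint : IntegrableOn (fun t : ℝ ↦ (1 / (π ^ 2 * lam)) * t ^ (-2:ℝ)) (Ioi Δ) :=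
    (integrableOn_Ioi_rpow_of_lt (by norm_num) hΔ).const_mul _
  calc ∫ α in Ioi Δ, g α ≤ ∫ α in Ioi Δ, (1 / (π ^ 2 * lam)) * α ^ (-2:ℝ) := by
        refine setIntegral_mono_on hgi.integrableOn hint measurableSet_Ioi fun t ht ↦ ?_
        have ht0 : 0 < t := hΔ.trans ht
        rw [hgdef, Montgomery1973.cosTransform_triangle hlam, Real.rpow_neg ht0.le, Real.rpow_two]
        calc lam * sinc (π * lam * t) ^ 2 ≤ 1 / (π ^ 2 * lam * t ^ 2) :=
              mul_sinc_sq_le_inv hlam ht0.ne'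
          _ = 1 / (π ^ 2 * lam) * (t ^ 2)⁻¹ := by
              field_simp
    _ = 1 / (π ^ 2 * lam * Δ) := by
        rw [integral_const_mul, integral_Ioi_rpow_of_lt (by norm_num) hΔ]
        rw [show (-2:ℝ) + 1 = -1 by norm_num, Real.rpow_neg_one]
        field_simp

/-- **Inner mass**: `∫₀¹ r̂_λ ≤ λ(1 − c²/9 + 2c⁴/225)`, `c = πλ`. -/
theorem integral_inner_le {lam : ℝ} (hlam : 0 < lam) :
    ∫ α in (0:ℝ)..1, BGMM2023.cosTransform (fun u : ℝ ↦ max (1 - |u| / lam) 0) α ≤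
      lam * (1 - (π * lam) ^ 2 / 9 + 2 * (π * lam) ^ 4 / 225) := by
  set c : ℝ := π * lam with hc
  have h1 : (∫ α in (0:ℝ)..1, BGMM2023.cosTransform (fun u : ℝ ↦ max (1 - |u| / lam) 0) α) =
      lam * ∫ α in (0:ℝ)..1, sinc (c * α) ^ 2 := by
    rw [← intervalIntegral.integral_const_mul]
    refine intervalIntegral.integral_congr fun α _ ↦ ?_
    simp only [Montgomery1973.cosTransform_triangle hlam, hc]
  rw [h1]
  have hmono : ∫ α in (0:ℝ)..1, sinc (c * α) ^ 2 ≤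
      ∫ α in (0:ℝ)..1, (1 - c ^ 2 * α ^ 2 / 3 + 2 * c ^ 4 * α ^ 4 / 45) := by
    refine intervalIntegral.integral_mono_on zero_le_one
      ((by fun_prop : Continuous fun a : ℝ ↦ sinc (c * a) ^ 2).intervalIntegrable _ _)
      ((by fun_prop : Continuous fun a : ℝ ↦ 1 - c ^ 2 * a ^ 2 / 3
        + 2 * c ^ 4 * a ^ 4 / 45).intervalIntegrable _ _)
      fun a _ ↦ sinc_sq_le a c
  rw [integral_poly₀] at hmono
  exact mul_le_mul_of_nonneg_left hmono hlam.le

/-- **First moment**: `λ(1/2 − c²/12 + c⁴/135 − c⁶/2520) ≤ ∫₀¹ α r̂_λ(α) dα`, `c = πλ`. -/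
theorem integral_moment_ge {lam : ℝ} (hlam : 0 < lam) :
    lam * (1 / 2 - (π * lam) ^ 2 / 12 + (π * lam) ^ 4 / 135 - (π * lam) ^ 6 / 2520) ≤
      ∫ α in (0:ℝ)..1, α * BGMM2023.cosTransform (fun u : ℝ ↦ max (1 - |u| / lam) 0) α := by
  set c : ℝ := π * lam with hc
  have h1 : (∫ α in (0:ℝ)..1, α * BGMM2023.cosTransform (fun u : ℝ ↦ max (1 - |u| / lam) 0) α) =
      lam * ∫ α in (0:ℝ)..1, α * sinc (c * α) ^ 2 := by
    rw [← intervalIntegral.integral_const_mul]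
    refine intervalIntegral.integral_congr fun α _ ↦ ?_
    simp only [Montgomery1973.cosTransform_triangle hlam, hc]
    ring
  rw [h1]
  have hmono : ∫ a in (0:ℝ)..1, (a - c ^ 2 * a ^ 3 / 3 + 2 * c ^ 4 * a ^ 5 / 45
      - c ^ 6 * a ^ 7 / 315) ≤ ∫ a in (0:ℝ)..1, a * sinc (c * a) ^ 2 := by
    refine intervalIntegral.integral_mono_on zero_le_one
      ((by fun_prop : Continuous fun a : ℝ ↦ a - c ^ 2 * a ^ 3 / 3 + 2 * c ^ 4 * a ^ 5 / 45
        - c ^ 6 * a ^ 7 / 315).intervalIntegrable _ _)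
      ((by fun_prop : Continuous fun a : ℝ ↦ a * sinc (c * a) ^ 2).intervalIntegrable _ _)
      fun a ha ↦ mul_sinc_sq_ge ha.1 c
  rw [integral_poly] at hmono
  exact mul_le_mul_of_nonneg_left hmono hlam.le

/-- **Closed-form lower bound for the floor certificate of the triangle** (`λ > 0`, `Δ ≥ 1`,
`f ≥ 0`, `c = πλ`):
`c_fl(r_λ; Δ, f) ≥ λ − 1 + 2λ(1/2 − c²/12 + c⁴/135 − c⁶/2520)
  + 2f(1/2 − λ(1 − c²/9 + 2c⁴/225) − 1/(π²λΔ))`. -/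
theorem floorCertificate_triangle_ge {lam Δ f : ℝ} (hlam : 0 < lam) (hΔ : 1 ≤ Δ) (hf : 0 ≤ f) :
    lam - 1 + 2 * (lam * (1 / 2 - (π * lam) ^ 2 / 12 + (π * lam) ^ 4 / 135 - (π * lam) ^ 6 / 2520))
      + 2 * f * (1 / 2 - lam * (1 - (π * lam) ^ 2 / 9 + 2 * (π * lam) ^ 4 / 225)
        - 1 / (π ^ 2 * lam * Δ)) ≤
    BGMM2023.cosTransform (fun u : ℝ ↦ max (1 - |u| / lam) 0) 0 - 1
      + 2 * (∫ α in (0:ℝ)..1, α * BGMM2023.cosTransform (fun u : ℝ ↦ max (1 - |u| / lam) 0) α)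
      + 2 * f * (∫ α in (1:ℝ)..Δ, BGMM2023.cosTransform (fun u : ℝ ↦ max (1 - |u| / lam) 0) α) := by
  rw [cosTransform_triangle_zero hlam, integral_window_eq hlam hΔ]
  have h1 := integral_moment_ge hlam
  have h2 := integral_inner_le hlam
  have h3 := integral_tail_le hlam (zero_lt_one.trans_le hΔ)
  have h4 : 2 * f * (1 / 2 - lam * (1 - (π * lam) ^ 2 / 9 + 2 * (π * lam) ^ 4 / 225)
      - 1 / (π ^ 2 * lam * Δ)) ≤ 2 * f * (1 / 2
      - (∫ α in (0:ℝ)..1, BGMM2023.cosTransform (fun u : ℝ ↦ max (1 - |u| / lam) 0) α)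
      - ∫ α in Ioi Δ, BGMM2023.cosTransform (fun u : ℝ ↦ max (1 - |u| / lam) 0) α) := by
    apply mul_le_mul_of_nonneg_left _ (by positivity)
    linarith
  linarith

/-! ## §3. The numbers `(Δ, λ, f) = (100, 0.499, 0.89)` and the item -/

/-- **The certified inequality**: the closed-form lower bound of §2 is positive at
`(Δ, λ, f) = (100, 0.499, 0.89)` (value `≈ 0.0254`; uses only `3.141592 < π < 3.141593`). -/
theorem floorBound_pos :
    0 < (0.499:ℝ) - 1 + 2 * (0.499 * (1 / 2 - (π * 0.499) ^ 2 / 12 + (π * 0.499) ^ 4 / 135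
      - (π * 0.499) ^ 6 / 2520))
      + 2 * 0.89 * (1 / 2 - 0.499 * (1 - (π * 0.499) ^ 2 / 9 + 2 * (π * 0.499) ^ 4 / 225)
        - 1 / (π ^ 2 * 0.499 * 100)) := by
  set c : ℝ := π * 0.499 with hc
  have hpi1 := pi_gt_d6
  have hpi2 := pi_lt_d6
  have hc1 : 3.141592 * 0.499 < c := by rw [hc]; nlinarith
  have hc2 : c < 3.141593 * 0.499 := by rw [hc]; nlinarith
  have hc0 : 0 < c := by linarith
  have h2l : (3.141592 * 0.499) ^ 2 < c ^ 2 := by gcongr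
  have h2u : c ^ 2 < (3.141593 * 0.499) ^ 2 := by gcongr
  have h4l : (3.141592 * 0.499) ^ 4 < c ^ 4 := by gcongr
  have h4u : c ^ 4 < (3.141593 * 0.499) ^ 4 := by gcongr
  have h6l : (3.141592 * 0.499) ^ 6 < c ^ 6 := by gcongr
  have h6u : c ^ 6 < (3.141593 * 0.499) ^ 6 := by gcongr
  have htail : 1 / (π ^ 2 * 0.499 * 100) ≤ 1 / (3.141592 ^ 2 * 0.499 * 100) := by
    apply one_div_le_one_div_of_le (by norm_num)
    have : (3.141592:ℝ) ^ 2 ≤ π ^ 2 := by gcongr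
    nlinarith
  norm_num at h2l h2u h4l h4u h6l h6u htail ⊢
  linarith

/-- **Item stmt-RiemannHypothesis-23031 (`DeltaCIFloorNineTenths`) holds**, witnessed by
Montgomery's triangle `r(u) = max(1 − |u|/0.499, 0)` at `(Δ, λ, f) = (100, 0.499, 0.89)`:
`r̂ = 0.499·sinc(0.499πα)² ≥ 0` everywhere and `c_fl(r; 100, 0.89) ≥ 0.0254 > 0`. A pure
real-analysis `∃`; nothing here bears on the truth of RH. -/
theorem DeltaCIFloorNineTenths_holds :
    Summit.RiemannHypothesis.RiemannHypothesis.Theses.GapsEvoDoors.DeltaCIFloorNineTenths := by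
  unfold Summit.RiemannHypothesis.RiemannHypothesis.Theses.GapsEvoDoors.DeltaCIFloorNineTenths
  have hlam : (0:ℝ) < 0.499 := by norm_num
  have hA := Montgomery1973.isAdmissible_triangle hlam
  refine ⟨100, 0.499, 0.89, fun u : ℝ ↦ max (1 - |u| / 0.499) 0, by norm_num, hlam, by norm_num,
    by norm_num, by norm_num, hA.even, Montgomery1973.continuous_triangle hlam,
    Montgomery1973.integrable_triangle hlam, integrable_cosTransform_triangle hlam, ?_, hA.nonpos,
    fun α _ ↦ hA.transform_nonneg α, fun α _ _ ↦ hA.transform_nonneg α, ?_⟩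
  · intro u
    refine max_le ?_ zero_le_one
    have : 0 ≤ |u| / 0.499 := by positivity
    linarith
  · exact lt_of_lt_of_le floorBound_pos
      (floorCertificate_triangle_ge hlam (by norm_num) (by norm_num))

end Summit.RiemannHypothesis.RiemannHypothesis.Theorems.GapsEvoDoorsFloor

end
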